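import Mathlib
import HarnessLib

/-!
# `OneFlightGossipEngine.OneFlightLayeredChaos` — exact conditioning splits along mutually singular pieces
# (crux stmt-AtomisticToContinuum-14535, line `Sketch`, lead c1; helper for `stub_floppy` / `stub_dust`)

The measure-theoretic core of the RANK DICHOTOMY recorded in the crux notes (Cruxes/OneFlightLayeredChaos/NOTES.md §D2):
the crux conditions on the σ-algebra `σ(T)` generated by a data map `T` (coarse past: cells + EXACT velocities at two
snapshots); configuration space splits into a piece `D` on which the push-forward of the law under `T` is SINGULAR with
respect to the push-forward of the complement (sparse inter-snapshot itineraries: the velocity data factors through too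
few contact normals) and its complement. Then `D` is `σ(T)`-measurable modulo a null set
(`exists_preimage_symmDiff_null_of_mutuallySingular`), so every defect of the crux's form computed with the window event
cut down to `D` IS a defect of the original form at another `σ(T)`-event (`abs_measureReal_defect_inter_eq`): the supremum
over `E ∈ σ(T)` sees the two pieces separately, and conditioning on `D` may ignore the complement entirely. Pure measure
theory (no hard-sphere objects); both lemmas are registered sub-goals of the item.
-/

open MeasureTheory Set

namespace Summit.AtomisticToContinuum.HydrodynamicLimit.Theorems.OLC

/-- **Mutually singular push-forwards make the piece observable.** If the push-forwards under a measurable map `T` of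
the restrictions of `P` to a set `D` and to its complement are mutually singular, then `D` coincides with a
`T`-preimage of a measurable set up to a `P`-null set. [folklore] -/
theorem exists_preimage_symmDiff_null_of_mutuallySingular {Ω Y : Type*} [MeasurableSpace Ω] [MeasurableSpace Y]
    (P : Measure Ω) {T : Ω → Y} (hT : Measurable T) {D : Set Ω}
    (h : (P.restrict D).map T ⟂ₘ (P.restrict Dᶜ).map T) :
    ∃ S : Set Y, MeasurableSet S ∧ P (symmDiff D (T ⁻¹' S)) = 0 := by
  obtain ⟨s, hs, hμ, hν⟩ := h
  refine ⟨sᶜ, hs.compl, ?_⟩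
  have h1 : P (D ∩ T ⁻¹' s) = 0 := by
    have := hμ
    rw [Measure.map_apply hT hs, Measure.restrict_apply (hT hs)] at this
    rwa [inter_comm] at this
  have h2 : P (Dᶜ ∩ T ⁻¹' sᶜ) = 0 := by
    have := hν
    rw [Measure.map_apply hT hs.compl, Measure.restrict_apply (hT hs.compl)] at this
    rwa [inter_comm] at this
  have hsub : symmDiff D (T ⁻¹' sᶜ) ⊆ (D ∩ T ⁻¹' s) ∪ (Dᶜ ∩ T ⁻¹' sᶜ) := by
    intro z hz
    rcases hz with ⟨hzD, hzS⟩ | ⟨hzS, hzD⟩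
    · left
      refine ⟨hzD, ?_⟩
      simpa [mem_preimage, mem_compl_iff] using hzS
    · right
      exact ⟨hzD, hzS⟩
  exact measure_mono_null hsub (by rw [measure_union_null h1 h2])

/-- **A null symmetric difference does not change the defect.** If `D` and `F` differ by a `P`-null set, the crux-type
defect with the window event cut down to `D` equals the defect of the uncut form at the event `E ∩ F` (for `F = T⁻¹' S`
with `E`, `T⁻¹' S ∈ σ(T)` this is again a `σ(T)`-event). [folklore] -/
theorem abs_measureReal_defect_inter_eq {Ω : Type*} [MeasurableSpace Ω] (P : Measure Ω)
    {D F : Set Ω} (hDF : P (symmDiff D F) = 0) (W A E : Set Ω) (u : ℝ) :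
    |(P (W ∩ A ∩ (D ∩ E))).toReal - u * (P (W ∩ (D ∩ E))).toReal| =
      |(P (W ∩ A ∩ (E ∩ F))).toReal - u * (P (W ∩ (E ∩ F))).toReal| := by
  have hae : (D : Set Ω) =ᵐ[P] F := measure_symmDiff_eq_zero_iff.1 hDF
  have e1 : (W ∩ A ∩ (D ∩ E) : Set Ω) =ᵐ[P] (W ∩ A ∩ (E ∩ F) : Set Ω) := by
    have : (W ∩ A ∩ (E ∩ F) : Set Ω) = W ∩ A ∩ (F ∩ E) := by rw [inter_comm E F]
    rw [this]
    exact (ae_eq_refl _).inter (hae.inter (ae_eq_refl _))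
  have e2 : (W ∩ (D ∩ E) : Set Ω) =ᵐ[P] (W ∩ (E ∩ F) : Set Ω) := by
    have : (W ∩ (E ∩ F) : Set Ω) = W ∩ (F ∩ E) := by rw [inter_comm E F]
    rw [this]
    exact (ae_eq_refl _).inter (hae.inter (ae_eq_refl _))
  rw [measure_congr e1, measure_congr e2]

end Summit.AtomisticToContinuum.HydrodynamicLimit.Theorems.OLC
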